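/-
Origin: expansion seat `prover-pub-hodgecm-mc-binder-1-g9-0`, handover #21 2026-08-19T21:06Z md5 ec53fb43d903 (NEW additive LIGHT KERNEL leaf; the INDEX JUNCTION (x-W)↔(x-Θ) of row 14: K_∞ ∋ k ↦ (k,1_f) = ιinf(π k) · a_k in the regime model with a_k ∈ satLevelRegimeOf V hV K for every K, det Jac (π k) x₀ = archKappa k; installs after #1097 + LevelSaturation + the two installed twins; RUN-37 (even RUN-36-world) eligible; drop ⇒ drop #22) (`HOME/mc/pub-hodgecm-mc-binder-1-g9/stage/HodgeCM/Model/Junction/KInftySplit.lean`, md5 ec53fb43, 192 lines);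
landed by the gen-13 packager (p-g13) in gate run 37 as `HodgeCM/Model/Junction/KInftySplit.lean` (verbatim).
-/
/-
Origin: speedrun cell pub-hodgecm, MODEL-CONSTRUCTION sub-cell, unit pub-hodgecm-mc-binder-1-g9 (BINDER PROVER, gen 9; node B2-meet,
BINDER-OWNERS row 14 `gen12`, the INDEX JUNCTION (x-W)↔(x-Θ)), seat prover-pub-hodgecm-mc-binder-1-g9-0, 2026-08-19.
Target in PKG: HodgeCM/Model/Junction/KInftySplit.lean (NEW additive LIGHT leaf, RUN 37+; imports period-1's #1097 `Model/ArchSideInstance`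
(RUN 36), mc-discharge-1's `Model/Junction/LevelSaturation` (RUN 36) and the installed tree twins `Automorphic/UnitaryGroupArchIsotropy`,
`GelbartRogawski1991/UnitaryDualPairThetaKernelCM` (for the identity bridge `cmAdelicEquiv` of unitary-1's `archIsotropyRegime`);
no pin, no E, no `WmInput`; nothing landed imports it).  KERNEL ONLY: one definition (a group element) and lemmas; 0 records, nothing cited,
0 `def … : Prop`, MODEL-N ±0.
-/
import Summits.HodgeConjecture.HodgeCM.Model.ArchSideInstance
import Summits.HodgeConjecture.HodgeCM.Model.Junction.LevelSaturation
import Literature.NumberTheory.Automorphic.UnitaryGroupArchIsotropy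
import Literature.NumberTheory.GelbartRogawski1991.UnitaryDualPairThetaKernelCM

/-!
# The index junction (x-W)↔(x-Θ) of row `gen12`: `K_∞ ∋ k = ιinf(π k) · a_k` with `a_k` in every saturation subgroup

Row 14's two producers index the archimedean compact differently:

* (x-W) (unitary-1, `WmInstanceV2KType`): the family `gK := archIsotropyRegime V hV τ T hT : K_∞ →* G_U(𝔸)`, `k ↦ (k, 1_f)` read in the
  regime model, `K_∞ = archIsotropy L V.Hm τ T hT = π_τ⁻¹(Stab x₀) ≤ U(V)(L ⊗ ℝ)` (tree `UnitaryGroupArchIsotropy`), character `archKappa`;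
* (x-Θ) (theta-3 (E4) via kit #18 `Gen12WedgeKTypeOfStrict`): elements `ιinf u · a` with `u ∈ Stab(x₀) ≤ U(2,1)` read through the S pin's
  `ιinf = archInfOf V` (#1097: the Sylvester-frame section at `ι₁`, `archInfOf_apply`) and `a` in the saturation subgroup
  `satLevelRegimeOf V hV K` of EVERY level (`Junction/LevelSaturation`), matrices `Jac u x₀`, character `isotropyDetChar u`.

At the frame of record `(τ, T) := (ι₁, V.sylvesterFrame)` the two agree ON THE NOSE:

* `kInftyCorr V k := (s (π k))⁻¹ · (k, 1_f)` (tree currency `U(V.Hm)(𝔸_{L⁺})`; `s = archSectionU21CM … ι₁ … V.sylvesterFrame`, `π = archProjU21EmbCM`)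
  lies in `awayFromCM` (its `ι₁`-component is `1`: tree `exists_eq_adelicSingle_mul` + `archLocalOfEmb_archAtEmb`, §0) and has finite part `1`,
  hence lies in `satLevelOf V K = awayFromCM ⊓ M_K` for EVERY `K` (`kInftyCorr_mem_satLevelOf`);
* `toLatticeModelG V (k, 1_f) = archInfOf V (π k) * toLatticeModelG V (kInftyCorr V k)` (`toLatticeModelG_archIsotropyToAdelic_eq`), and in the
  regime `toLatticeModelG V (kInftyCorr V k) ∈ satLevelRegimeOf V hV K` (`toLatticeModelG_kInftyCorr_mem`);
* `det (Jac (π k) x₀) = archKappa k` is the tree's `coe_archKappa` (rfl) — kit #12's `hdet`.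
The consumer (`Model/Binders/Gen12SeesawOfArchSideKInfty`) rewrites unitary-1's `archIsotropyRegime V hV ι₁ V.sylvesterFrame _ k` as
`toLatticeModelG V ((cmAdelicEquiv …).symm (archIsotropyToAdelic … k))` (definitional up to `toRegime_apply_of`) and feeds kit #18's
`hA_of_strict`/`hB_of_strict` with `uOf := archIsotropyProj`, `aOf := toLatticeModelG V ∘ kInftyCorr V`.  CURRENCY NOTE for node E / unitary-1:
the W pin's ball frame must be `(τ, T, hT) := (ι₁, V.sylvesterFrame, formCongr_eq_of_conjTranspose … (sylvesterFrame_J V))` — the SAME frame as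
the S pin's `ιinf` (#1097) — for the two `K_∞`'s to be one subgroup; any other `T` gives a conjugate maximal compact.
Nothing here is a claim of the manuscripts under adjudication.
-/

set_option autoImplicit false

noncomputable section

open NumberField MulAction
open scoped Matrix

/-! ## 0. Tree-currency splitting of an archimedean element along the `U(2,1)` section (API twin of
`UnitaryGroupArchSection.exists_eq_adelicSingle_mul` / `exists_toAdelic_eq_archSectionU21Emb_mul`, [BorelJacquet1979 §4.1] bookkeeping) -/

namespace HodgeCM.Model.ArchSplit

open Literature.NumberTheory.Automorphic Literature.NumberTheory.Automorphic.UnitaryGroup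
open Literature.Geometry.ComplexHyperbolic Literature.Geometry.ComplexHyperbolic.BallModel

/- PKG-owned namespace `HodgeCM.Model.ArchSplit` (no tree FQN is minted here; a tree twin of § 0 may later join
`Literature/NumberTheory/Automorphic/UnitaryGroupArchSection.lean`, whose API it extends by three bookkeeping lemmas). -/

section Generic

variable (F E : Type) [Field F] [NumberField F] [Field E] [NumberField E] [Algebra F E]
  (c : E ≃ₐ[F] E) (hc : c ≠ 1) (hfix : ∀ w : InfinitePlace E, c • w = w) (τ : E →+* ℂ) (hτ : InfinitePlace.IsComplex (InfinitePlace.mk τ))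
  (J₃ : Matrix (Fin 3) (Fin 3) E) (T : GL (Fin 3) ℂ) (hT : formCongr (starRingEnd ℂ) T (J₃.map τ) = BallModel.J)

/-- **Splitting of an ARCHIMEDEAN element along the section**: `(a, 1_f) = archSectionU21Emb τ T (π_τ a) · k` with `k ∈ awayFrom (mk τ)`
(`exists_eq_adelicSingle_mul` at `g := (a, 1_f)`; the `mk τ`-component of `a` in frame coordinates is `π_τ a`, `archLocalOfEmb_archAtEmb`). -/
theorem exists_archToAdelic_eq_archSectionU21Emb_mul (a : arch F E c 3 J₃) :
    ∃ k ∈ awayFrom F E c 3 J₃ hc hfix (placeOf E τ hτ),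
      archToAdelic F E c 3 J₃ a =
        archSectionU21Emb F E c hc hfix τ hτ J₃ T hT (archProjU21Emb F E c J₃ τ hτ T hT (hfix _) hc a) * k := by
  obtain ⟨k, hk, h⟩ := exists_eq_adelicSingle_mul F E c 3 J₃ hc hfix (placeOf E τ hτ) (archToAdelic F E c 3 J₃ a)
  refine ⟨k, hk, ?_⟩
  have h1 : archProjU21Emb F E c J₃ τ hτ T hT (hfix _) hc a =
      formEquivU21 E J₃ τ T hT (archAtEmb F E c 3 J₃ τ hτ (hfix _) hc a) := rfl
  rw [archPart_archToAdelic] at h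
  rw [archSectionU21Emb_apply, h1, ContinuousMulEquiv.symm_apply_apply, archLocalOfEmb_archAtEmb]
  exact h

/-- … hence `(s (π_τ a))⁻¹ · (a, 1_f) ∈ awayFrom (mk τ)`. -/
theorem archSectionU21Emb_inv_mul_archToAdelic_mem_awayFrom (a : arch F E c 3 J₃) :
    (archSectionU21Emb F E c hc hfix τ hτ J₃ T hT (archProjU21Emb F E c J₃ τ hτ T hT (hfix _) hc a))⁻¹ * archToAdelic F E c 3 J₃ a ∈
      awayFrom F E c 3 J₃ hc hfix (placeOf E τ hτ) := by
  obtain ⟨k, hk, h⟩ := exists_archToAdelic_eq_archSectionU21Emb_mul F E c hc hfix τ hτ J₃ T hT a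
  rw [h, inv_mul_cancel_left]
  exact hk

/-- … and it has trivial finite part. -/
theorem finPart_archSectionU21Emb_inv_mul_archToAdelic (u : U21) (a : arch F E c 3 J₃) :
    finPart F E c 3 J₃ ((archSectionU21Emb F E c hc hfix τ hτ J₃ T hT u)⁻¹ * archToAdelic F E c 3 J₃ a) = 1 := by
  rw [map_mul, map_inv, archSectionU21Emb_apply, finPart_adelicSingle, finPart_archToAdelic, inv_one, mul_one]

end Generic

end HodgeCM.Model.ArchSplit

/-! ## 1. At the S pin's frame `(ι₁, V.sylvesterFrame)`: the corrector `kInftyCorr V k` and its two memberships -/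

namespace HodgeCM.Model

open Literature.NumberTheory.Automorphic Literature.NumberTheory.Automorphic.UnitaryGroup
open Literature.NumberTheory.GelbartRogawski1991.UnitaryDualPair (cmAdelicEquiv)
open Literature.Geometry.ComplexHyperbolic.BallModel (U21 x₀ Jac)

variable {L : CMField} {ι₁ : L →+* ℂ} (V : HermSpace3 L ι₁)

/-- the Sylvester frame identity in the `formCongr` spelling (the `hT` of `archIsotropy` / `archProjU21EmbCM` / unitary-1's `archIsotropyRegime`
at the frame of record). -/
theorem sylvesterFrame_formCongr :
    formCongr (starRingEnd ℂ) V.sylvesterFrame (V.Hm.map ι₁) = Literature.Geometry.ComplexHyperbolic.BallModel.J :=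
  formCongr_eq_of_conjTranspose (L : Type) ι₁ V.Hm V.sylvesterFrame (sylvesterFrame_J V)

/-- `K_∞` of record: the archimedean isotropy of the base point read at `ι₁` through the Sylvester frame. -/
abbrev KInfty : Subgroup (arch (↥(maximalRealSubfield L)) (L : Type) (IsCMField.complexConj L) 3 V.Hm) :=
  archIsotropy (L : Type) V.Hm ι₁ V.sylvesterFrame (sylvesterFrame_formCongr V)

/-- **the corrector** `kInftyCorr V k := (s (π k))⁻¹ · (k, 1_f) ∈ U(V.Hm)(𝔸_{L⁺})` (tree currency; `s` = the Sylvester-frame section at `ι₁`,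
`π = archProjU21EmbCM`, `(k, 1_f) = archIsotropyToAdelic k` read through the identity bridge `cmAdelicEquiv`). -/
def kInftyCorr (k : ↥(KInfty V)) : ↥(Literature.NumberTheory.Automorphic.adelicUnitaryGroup (L : Type) V.Hm) :=
  (archSectionU21CM (L : Type) ι₁ V.Hm V.sylvesterFrame (sylvesterFrame_J V)
      (archProjU21EmbCM (L : Type) V.Hm ι₁ V.sylvesterFrame (sylvesterFrame_formCongr V) k))⁻¹ *
    (cmAdelicEquiv (L : Type) 3 V.Hm).symm (archIsotropyToAdelic (L : Type) V.Hm ι₁ V.sylvesterFrame (sylvesterFrame_formCongr V) k)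

/-- `s (π k) · kInftyCorr V k = (k, 1_f)` (group algebra). -/
theorem archSectionU21CM_mul_kInftyCorr (k : ↥(KInfty V)) :
    archSectionU21CM (L : Type) ι₁ V.Hm V.sylvesterFrame (sylvesterFrame_J V)
        (archProjU21EmbCM (L : Type) V.Hm ι₁ V.sylvesterFrame (sylvesterFrame_formCongr V) k) * kInftyCorr V k =
      (cmAdelicEquiv (L : Type) 3 V.Hm).symm (archIsotropyToAdelic (L : Type) V.Hm ι₁ V.sylvesterFrame (sylvesterFrame_formCongr V) k) :=
  mul_inv_cancel_left _ _

/-- **`kInftyCorr V k ∈ awayFromCM`** — its `ι₁`-component is trivial (§0 at the CM data; `cmAdelicEquiv` is the identity bridge). -/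
theorem kInftyCorr_mem_awayFromCM (k : ↥(KInfty V)) : kInftyCorr V k ∈ awayFromCM 3 (L : Type) ι₁ V.Hm := by
  unfold kInftyCorr
  exact ArchSplit.archSectionU21Emb_inv_mul_archToAdelic_mem_awayFrom (↥(maximalRealSubfield L)) (L : Type) (IsCMField.complexConj L)
    (IsCMField.complexConj_ne_one L) (UnitaryGroup.complexConj_smul_infinitePlace (L : Type)) ι₁ (isComplex_mk_of_isCMField (L : Type) ι₁) V.Hm
    V.sylvesterFrame (sylvesterFrame_formCongr V) k

/-- **`kInftyCorr V k ∈ M_K` for EVERY finite level `K`** — its finite part is `1`. -/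
theorem kInftyCorr_mem_cmSplitLevel (K : Subgroup (finAdelic (↥(maximalRealSubfield L)) (L : Type) (IsCMField.complexConj L) 3 V.Hm))
    (k : ↥(KInfty V)) : kInftyCorr V k ∈ cmSplitLevel (L : Type) 3 V.Hm K := by
  rw [mem_cmSplitLevel_iff]
  have h : (cmAdelicProdEquiv (L : Type) 3 V.Hm (kInftyCorr V k)).2 = 1 :=
    ArchSplit.finPart_archSectionU21Emb_inv_mul_archToAdelic (↥(maximalRealSubfield L)) (L : Type) (IsCMField.complexConj L)
      (IsCMField.complexConj_ne_one L) (UnitaryGroup.complexConj_smul_infinitePlace (L : Type)) ι₁ (isComplex_mk_of_isCMField (L : Type) ι₁) V.Hm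
      V.sylvesterFrame (sylvesterFrame_formCongr V) _ k
  rw [h]
  exact one_mem K

/-- **`kInftyCorr V k ∈ satLevelOf V K` for every `K`.** -/
theorem kInftyCorr_mem_satLevelOf (K : Subgroup (finAdelic (↥(maximalRealSubfield L)) (L : Type) (IsCMField.complexConj L) 3 V.Hm))
    (k : ↥(KInfty V)) : kInftyCorr V k ∈ satLevelOf V K :=
  (mem_satLevelOf_iff V K _).2 ⟨kInftyCorr_mem_awayFromCM V k, kInftyCorr_mem_cmSplitLevel V K k⟩

/-- in the regime, `toLatticeModelG V` IS `regimeEquiv` (J0(d) twin + `toRegime_apply_of`). -/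
theorem toLatticeModelG_eq_regimeEquiv (hV : IsAnisotropic L V.Hm)
    (g : ↥(Literature.NumberTheory.Automorphic.adelicUnitaryGroup (L : Type) V.Hm)) :
    toLatticeModelG V g = HodgeCM.Adelic.regimeEquiv L V.Hm hV g := by
  rw [toLatticeModelG_apply, Adelic.toRegime_apply_of L V.Hm hV]
  rfl

/-- **regime version: `toLatticeModelG V (kInftyCorr V k) ∈ satLevelRegimeOf V hV K` for every `K`.** -/
theorem toLatticeModelG_kInftyCorr_mem (hV : IsAnisotropic L V.Hm)
    (K : Subgroup (finAdelic (↥(maximalRealSubfield L)) (L : Type) (IsCMField.complexConj L) 3 V.Hm)) (k : ↥(KInfty V)) :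
    toLatticeModelG V (kInftyCorr V k) ∈ satLevelRegimeOf V hV K := by
  rw [toLatticeModelG_eq_regimeEquiv V hV]
  exact mem_satLevelRegimeOf_of_mem V hV K (kInftyCorr_mem_satLevelOf V K k)

/-- **the index junction, regime model**: `(k, 1_f)` read in the regime model is `archInfOf V (π k) · toLatticeModelG V (kInftyCorr V k)`. -/
theorem toLatticeModelG_archIsotropyToAdelic_eq (k : ↥(KInfty V)) :
    toLatticeModelG V ((cmAdelicEquiv (L : Type) 3 V.Hm).symm
        (archIsotropyToAdelic (L : Type) V.Hm ι₁ V.sylvesterFrame (sylvesterFrame_formCongr V) k)) =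
      archInfOf V (archProjU21EmbCM (L : Type) V.Hm ι₁ V.sylvesterFrame (sylvesterFrame_formCongr V) k : U21) *
        toLatticeModelG V (kInftyCorr V k) := by
  rw [archInfOf_apply, ← map_mul, archSectionU21CM_mul_kInftyCorr]

/-- the same with `π k` spelled through the tree's `archIsotropyProj` (kit #18's `uOf : K_∞ → Stab(x₀)`; `coe_archIsotropyProj` is `rfl`). -/
theorem toLatticeModelG_archIsotropyToAdelic_eq' (k : ↥(KInfty V)) :
    toLatticeModelG V ((cmAdelicEquiv (L : Type) 3 V.Hm).symm
        (archIsotropyToAdelic (L : Type) V.Hm ι₁ V.sylvesterFrame (sylvesterFrame_formCongr V) k)) =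
      archInfOf V ((archIsotropyProj (L : Type) V.Hm ι₁ V.sylvesterFrame (sylvesterFrame_formCongr V) k : stabilizer U21 x₀) : U21) *
        toLatticeModelG V (kInftyCorr V k) :=
  toLatticeModelG_archIsotropyToAdelic_eq V k

/-- **`hdet` of kit #12 at `K_∞`**: `det (Jac (π k) x₀) = archKappa k` (tree `coe_archKappa`, definitional). -/
theorem det_Jac_archIsotropyProj (k : ↥(KInfty V)) :
    (Jac ((archIsotropyProj (L : Type) V.Hm ι₁ V.sylvesterFrame (sylvesterFrame_formCongr V) k : stabilizer U21 x₀) : U21) x₀).det =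
      ((archKappa (L : Type) V.Hm ι₁ V.sylvesterFrame (sylvesterFrame_formCongr V) k : ℂˣ) : ℂ) :=
  (coe_archKappa (L : Type) V.Hm ι₁ V.sylvesterFrame (sylvesterFrame_formCongr V) k).symm

end HodgeCM.Model

end
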